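import Literature.Geometry.Kaehler.ComplexTorusTotallyRealFieldCentralizerLefschetzLieAlgebraDimension
import Literature.Geometry.Kaehler.ComplexTorusSimpleEndomorphismCenter
import Literature.Geometry.Kaehler.ComplexTorusCentralizerSkewForms
import Literature.Geometry.Kaehler.ComplexTorusAlbertTypeIVLefschetzGroupConnected
import Literature.RingTheory.CentralSimple.DoubleCentralizer
import Literature.RingTheory.CentralSimple.AlbertTypes
import Mathlib.Algebra.Central.Matrix
import HarnessLib

/-!
# Milne's table, TYPE IV in EVERY degree `(e₀, d)`: `[End_ℚ(X) : ℚ] · dim_ℚ Lie S(X) = 2g²` for a simple polarised complex torus whose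
# endomorphism algebra has a CM centre (`S(X) = Res U`; «IV ∣ `GL_{g/(df)}` ∣ … ∣ `g²/(d²f)`», `[End_ℚ(X):ℚ] = 2fd²`)

Layer `Literature/Geometry/Kaehler`, namespace `Literature.Geometry.Kaehler.ComplexTorus`; lane `lit-hodgefound` (Track 2
foundations library); prover seat `lit-hodgefound-p17`, generation 59, self-proposed row g59-#6 — the general-`d` form of ✔ g58-#9
(`ComplexTorusCMFieldCentralizerLefschetzLieAlgebraDimension`: `d = 1`, `End_ℚ(X) = F` a CM field), completing with ✔ g59-#2 (type I)
and ✔ g59-#5 (types II, III) the «Dimension» column of Milne's Summary table at torus level.  THEOREMS ONLY (no definition, no instance,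
no notation, no named fact; D-0026 net debt `0`).

## The argument

`X` simple ⟹ `D = End_ℚ(X)` is a skew field (tree: `IsSimple.divisionRing`), simple as a ring, inside the central simple `M_{2g}(ℚ)`; the
double centralizer theorem (tree: `DoubleCentralizer.finrank_mul_finrank_centralizer`, Voight Prop. 7.7.8 (b)) gives
`[D:ℚ] · dim_ℚ C(D) = (2g)²`.  The Rosati involution `†` preserves `C = C(D)` (tree: `IsRiemannForm.rosati_mem_centralizer_endAlgRat`)
and is complex conjugation on the CM centre `K` (tree: `IsSimple.rosati_val_eq_complexConj`, Deligne I 5.1 ∕ Shimura Prop. 5); with a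
non-zero `θ ∈ K`, `θ̄ = −θ`, `A ↦ θA` exchanges `C⁺` and `C⁻ = Lie S(X)` (Milne §1: «`S(A)(R) = {γ ∈ C(A) ⊗ R ∣ γ†γ = 1}`»), so
`2 dim Lie S(X) = dim C` and `[D:ℚ] · dim Lie S(X) = 2g²` (with `[D:ℚ] = 2fd²`, `f = [K₀:ℚ]`: `dim S(X) = g²/(d²f)`, the table's type IV entry).

## Sources, VERBATIM

* J. S. Milne [Milne1999LefschetzClasses], Duke Math. J. **96** (1999) (held `paper:doi-10-1215-s0012-7094-99-09620-5`), §1 p. 643–644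
  («The `k`-algebra `C(A)` … `S(A)(R) = {γ ∈ C(A) ⊗_k R ∣ γ†γ = 1}`»), §2 p. 651 «Simple abelian variety of type IV» («`S_σ ≈ Aut_{M_d}(V₁) ≈
  GL_{g/(fd)}`», p0013 L79) and Summary table p. 652 (p0014: «IV ∣ `GL_{g/(df)}` ∣ No ∣ Yes ∣ `g²/(d²f)` ∣ `g/d`», «The group `S(A)_{/k^al}` is
  isomorphic to `f` copies of the group listed in the second column»).
* J. Voight [Voight2021], *Quaternion Algebras*, §7.7 Prop. 7.7.8 (b) («`dim_F B = dim_F A · dim_F C_B(A)`»), via `DoubleCentralizer.lean`.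
* P. Deligne [Deligne1982HodgeCycles], I Prop. 5.1 (the Rosati involution induces complex conjugation on a CM subfield).

## What is proved (`X` simple, `η` a Riemann form with rational Gram matrix `G`, `K = centerField`)

* §1 **`IsSimple.finrank_endAlgRat_mul_finrank_centralizer_eq_card_sq`**: `[End_ℚ(X):ℚ] · dim_ℚ C(End_ℚ X) = #ι²` (any simple torus).
* §2 **`IsSimple.two_mul_finrank_lefschetzLieRat_eq_finrank_centralizer_of_isCMField`**: `2 · dim_ℚ Lie S(X) = dim_ℚ C(End_ℚ X)` when `K`
  is a CM field.
* §3 **`IsSimple.finrank_endAlgRat_mul_finrank_lefschetzLieRat_eq_of_isCMField`**: `[End_ℚ(X):ℚ] · dim_ℚ Lie S(X) = 2g²`; the `𝔩𝔣` form;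
  the Hodge bound `[End_ℚ(X):ℚ] · dim_ℝ 𝔥𝔤_ℝ ≤ 2g²`; `Hg(ℂ) = Lf(ℂ)` ⟺ equality; the `IsAlbertTypeIV` front-ends; and, `S(X)` being
  connected for type IV (tree: `IsSimple.lefschetzIdentityC_eq_lefschetzGroupC_of_isAlbertTypeIV`), criterion (D) on all powers ⟺
  `[End_ℚ(X):ℚ] · dim_ℝ 𝔥𝔤_ℝ = 2g²` (`IsSimple.forall_divisorClasses_powPeriod_eq_hodgeClasses_iff_…_of_isAlbertTypeIV`).
* §4 the table's «IV ∣ … ∣ Semisimple: No»: **`IsSimple.not_isSemisimple_lefschetzLieRat_of_isCMField`** — `Lie S(X)` has the non-zero central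
  element `θ ∈ K`, `θ̄ = −θ` (`IsSimple.exists_ne_zero_mem_lefschetzLieRat_forall_mul_comm_of_isCMField`, `IsSimple.center_lefschetzLieRat_ne_bot_of_isCMField`).
-/

noncomputable section

open scoped Matrix
open Module Matrix Complex Function NumberField
open Literature.RingTheory.CentralSimple (IsAlbertTypeIV)

namespace Literature.Geometry.Kaehler

namespace ComplexTorus

section TypeFour

variable {κ : Type} [Fintype κ] [DecidableEq κ] [Nonempty κ] {E : Type} [NormedAddCommGroup E] [NormedSpace ℂ E]
  {Ψ : (κ → ℝ) ≃L[ℝ] E} {η : E [⋀^Fin 2]→L[ℝ] ℝ} {G : Matrix κ κ ℚ}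

/-! ## §1 The double centralizer count `[End_ℚ(X):ℚ] · dim C(End_ℚ X) = (2g)²` -/

/-- **`[End_ℚ(X) : ℚ] · dim_ℚ C(End_ℚ(X)) = #ι²` FOR A SIMPLE TORUS** (`End_ℚ(X)` is a skew field, hence a simple subalgebra of the
central simple `M_ι(ℚ)`; Voight Prop. 7.7.8 (b)). [cite: Voight2021, §7.7 Prop. 7.7.8 (b)] [cite: Milne1999LefschetzClasses, §1 p. 643 («The `k`-algebra `C(A)`»)] -/
theorem IsSimple.finrank_endAlgRat_mul_finrank_centralizer_eq_card_sq (hX : IsSimple Ψ) :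
    finrank ℚ (endAlgRat Ψ) * finrank ℚ ↥(Subalgebra.centralizer ℚ (endAlgRat Ψ : Set (Matrix κ κ ℚ))) = Fintype.card κ ^ 2 := by
  letI : DivisionRing (endAlgRat Ψ) := hX.divisionRing
  rw [Literature.RingTheory.CentralSimple.finrank_mul_finrank_centralizer (F := ℚ) (endAlgRat Ψ), Module.finrank_matrix,
    Module.finrank_self, mul_one, sq]

/-! ## §2 `2 · dim_ℚ Lie S(X) = dim_ℚ C(End_ℚ X)` for a CM centre -/

/-- **`2 · dim_ℚ Lie S(X) = dim_ℚ C(End_ℚ(X))` WHEN THE CENTRE `K` OF `End_ℚ(X)` IS A CM FIELD** (type IV, every `(e₀, d)`): `†` preserves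
`C = C(End_ℚ X)` and is complex conjugation on `K`; `C = C⁺ ⊕ C⁻`, `C⁻ = Lie S(X)`, and `A ↦ θ A` (`θ ∈ K×`, `θ̄ = −θ`) exchanges `C±`.
[cite: Milne1999LefschetzClasses, §1 (p. 644: «`S(A)(R) = {γ ∈ C(A) ⊗_k R ∣ γ†γ = 1}`») and §2 (type IV)] [cite: Deligne1982HodgeCycles, I Prop. 5.1] -/
theorem IsSimple.two_mul_finrank_lefschetzLieRat_eq_finrank_centralizer_of_isCMField (hX : IsSimple Ψ) (hη : IsRiemannForm Ψ η)
    (hG : G.map (Rat.cast : ℚ → ℝ) = latticeGram Ψ η) [IsCMField (centerField Ψ hX)] :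
    2 * finrank ℚ (lefschetzLieRat Ψ G) = finrank ℚ ↥(Subalgebra.centralizer ℚ (endAlgRat Ψ : Set (Matrix κ κ ℚ))) := by
  letI : LieRing (Matrix κ κ ℚ) := LieRing.ofAssociativeRing
  set K := centerField Ψ hX
  have hGu : IsUnit G.det := isUnit_det_of_map_ratCast hG hη.isUnit_det_latticeGram
  have hGt : Gᵀ = -G := transpose_eq_neg_of_map_ratCast Ψ hG
  have hconj : ∀ z : K, rosati G (centerField.val Ψ hX z) = centerField.val Ψ hX (IsCMField.complexConj K z) :=
    hX.rosati_val_eq_complexConj hη hG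
  set C := Subalgebra.centralizer ℚ (endAlgRat Ψ : Set (Matrix κ κ ℚ)) with hCdef
  have memC : ∀ {A : Matrix κ κ ℚ}, A ∈ C ↔ ∀ B ∈ endAlgRat Ψ, B * A = A * B := fun {A} ↦ by
    rw [hCdef, Subalgebra.mem_centralizer_iff]; rfl
  -- `Lie S(X) = C⁻`
  change 2 * finrank ℚ (lefschetzLieRat Ψ G).toSubmodule = _
  set W := (lefschetzLieRat Ψ G).toSubmodule with hW
  have memW : ∀ A, A ∈ W ↔ A ∈ C ∧ rosati G A = -A := fun A ↦ by
    rw [hW, LieSubalgebra.mem_toSubmodule, mem_lefschetzLieRat_iff_rosati hGu, memC]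
    exact ⟨fun h ↦ ⟨fun B hB ↦ (h.1 B hB).symm, h.2⟩, fun h ↦ ⟨fun B hB ↦ (h.1 B hB).symm, h.2⟩⟩
  -- `†` preserves `C`
  have rosC : ∀ {A : Matrix κ κ ℚ}, A ∈ C → rosati G A ∈ C := fun {A} hA ↦ hη.rosati_mem_centralizer_endAlgRat hG hA
  -- `C⁺`
  let S : Submodule ℚ (Matrix κ κ ℚ) :=
    { carrier := {A | A ∈ C ∧ rosati G A = A}
      add_mem' := fun {A B} hA hB ↦ ⟨C.add_mem hA.1 hB.1, by rw [rosati_add, hA.2, hB.2]⟩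
      zero_mem' := ⟨C.zero_mem, by rw [show rosati G (0 : Matrix κ κ ℚ) = 0 from by simp [rosati_def]]⟩
      smul_mem' := fun c {A} hA ↦ ⟨C.smul_mem hA.1 c, by rw [rosati_smul, hA.2]⟩ }
  have memS : ∀ A, A ∈ S ↔ A ∈ C ∧ rosati G A = A := fun A ↦ Iff.rfl
  -- `C = C⁺ ⊕ C⁻`
  have hinf : W ⊓ S = ⊥ := by
    rw [Submodule.eq_bot_iff]
    intro A hA
    obtain ⟨hAW, hAS⟩ := Submodule.mem_inf.1 hA
    have h1 := ((memS A).1 hAS).2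
    have h2 := ((memW A).1 hAW).2
    have h : (2 : ℚ) • A = 0 := by rw [two_smul]; nth_rw 1 [← h1]; rw [h2, neg_add_cancel]
    exact (smul_eq_zero.1 h).resolve_left two_ne_zero
  have hsup : W ⊔ S = Subalgebra.toSubmodule C := by
    refine le_antisymm (sup_le (fun A hA ↦ ((memW A).1 hA).1) fun A hA ↦ ((memS A).1 hA).1) fun A hA ↦ ?_
    rw [Subalgebra.mem_toSubmodule] at hA
    rw [Submodule.mem_sup]
    refine ⟨(1 / 2 : ℚ) • (A - rosati G A), ?_, (1 / 2 : ℚ) • (A + rosati G A), ?_, ?_⟩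
    · rw [memW]
      exact ⟨C.smul_mem (C.sub_mem hA (rosC hA)) _,
        by rw [rosati_smul, rosati_sub, rosati_rosati hGu hGt, ← smul_neg, neg_sub]⟩
    · rw [memS]
      exact ⟨C.smul_mem (C.add_mem hA (rosC hA)) _, by rw [rosati_smul, rosati_add, rosati_rosati hGu hGt, add_comm]⟩
    · rw [← smul_add, sub_add_add_cancel, ← two_smul ℚ, smul_smul]
      norm_num
  have hdim := Submodule.finrank_sup_add_finrank_inf_eq W S
  rw [hinf, finrank_bot, add_zero, hsup, Subalgebra.finrank_toSubmodule] at hdim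
  -- a non-zero totally imaginary `x₀ ∈ K` and `θ = val x₀`
  obtain ⟨x₀, hx0, hxbar⟩ : ∃ x₀ : K, x₀ ≠ 0 ∧ IsCMField.complexConj K x₀ = -x₀ := by
    obtain ⟨x, hx⟩ : ∃ x : K, IsCMField.complexConj K x ≠ x := by
      by_contra! h
      exact IsCMField.complexConj_ne_one K (AlgEquiv.ext h)
    exact ⟨x - IsCMField.complexConj K x, sub_ne_zero.2 hx.symm, by rw [map_sub, IsCMField.complexConj_apply_apply, neg_sub]⟩
  set θ := centerField.val Ψ hX x₀ with hθ
  have hθC : θ ∈ C := memC.2 fun B hB ↦ (centerField.val_comm Ψ hX x₀ hB).symm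
  have hθE : θ ∈ endAlgRat Ψ := centerField.val_mem Ψ hX x₀
  have hθinv : centerField.val Ψ hX x₀⁻¹ * θ = 1 := by rw [hθ, ← map_mul, inv_mul_cancel₀ hx0, map_one]
  -- `(θ · A)† = −(θ · A†)` on `C`
  have key : ∀ {A : Matrix κ κ ℚ}, A ∈ C → rosati G (θ * A) = -(θ * rosati G A) := fun {A} hA ↦ by
    rw [rosati_mul hGu, hθ, hconj, hxbar, map_neg, mul_neg, ← hθ, memC.1 (rosC hA) θ hθE]
  -- the two injections `C⁻ ↪ C⁺`, `C⁺ ↪ C⁻`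
  have inj : ∀ {A : Matrix κ κ ℚ}, θ * A = 0 → A = 0 := fun {A} h ↦ by
    rw [← one_mul A, ← hθinv, mul_assoc, h, mul_zero]
  let m₁ : W →ₗ[ℚ] S :=
    { toFun := fun A ↦ ⟨θ * A.1, C.mul_mem hθC ((memW A.1).1 A.2).1,
        by rw [key ((memW A.1).1 A.2).1, ((memW A.1).1 A.2).2, mul_neg, neg_neg]⟩
      map_add' := fun A B ↦ by ext1; simp [mul_add]
      map_smul' := fun c A ↦ by ext1; simp }
  let m₂ : S →ₗ[ℚ] W :=
    { toFun := fun A ↦ ⟨θ * A.1, (memW _).2 ⟨C.mul_mem hθC ((memS A.1).1 A.2).1,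
        by rw [key ((memS A.1).1 A.2).1, ((memS A.1).1 A.2).2]⟩⟩
      map_add' := fun A B ↦ by ext1; simp [mul_add]
      map_smul' := fun c A ↦ by ext1; simp }
  have hm₁ : Function.Injective m₁ := by
    intro A B h
    have h' : θ * A.1 = θ * B.1 := congr_arg Subtype.val h
    exact Subtype.ext (sub_eq_zero.1 (inj (by rw [mul_sub, h', sub_self])))
  have hm₂ : Function.Injective m₂ := by
    intro A B h
    have h' : θ * A.1 = θ * B.1 := congr_arg Subtype.val h
    exact Subtype.ext (sub_eq_zero.1 (inj (by rw [mul_sub, h', sub_self])))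
  have hWS : finrank ℚ W = finrank ℚ S :=
    le_antisymm (LinearMap.finrank_le_finrank_of_injective hm₁) (LinearMap.finrank_le_finrank_of_injective hm₂)
  omega

/-! ## §3 Milne's table, type IV: `[End_ℚ(X):ℚ] · dim_ℚ Lie S(X) = 2g²` -/

variable [FiniteDimensional ℂ E]

/-- **MILNE'S TABLE, TYPE IV, EVERY `(e₀, d)`: `[End_ℚ(X) : ℚ] · dim_ℚ Lie S(X) = 2g²`** for a SIMPLE polarised complex torus whose endomorphism
algebra has a CM centre (`[End_ℚ(X):ℚ] = 2e₀d²` with `e₀ = [K₀:ℚ]` the degree of the maximal real subfield of the centre, so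
`dim S(X) = g²/(d²e₀)`: the table's «IV ∣ `GL_{g/(df)}` ∣ No ∣ Yes ∣ `g²/(d²f)`», «`f` copies of the group listed»). [cite: Milne1999LefschetzClasses, §2 «Simple abelian variety of type IV» (p. 651) and Summary table (p. 652, type IV)]
[cite: Voight2021, §7.7 Prop. 7.7.8 (b)] [cite: Deligne1982HodgeCycles, I Prop. 5.1] -/
theorem IsSimple.finrank_endAlgRat_mul_finrank_lefschetzLieRat_eq_of_isCMField (hX : IsSimple Ψ) (hη : IsRiemannForm Ψ η)
    (hG : G.map (Rat.cast : ℚ → ℝ) = latticeGram Ψ η) [IsCMField (centerField Ψ hX)] :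
    finrank ℚ (endAlgRat Ψ) * finrank ℚ (lefschetzLieRat Ψ G) = 2 * finrank ℂ E ^ 2 := by
  have h1 := hX.two_mul_finrank_lefschetzLieRat_eq_finrank_centralizer_of_isCMField hη hG
  have h2 := hX.finrank_endAlgRat_mul_finrank_centralizer_eq_card_sq
  rw [card_eq_two_mul_finrank Ψ] at h2
  have h3 : 2 * (finrank ℚ (endAlgRat Ψ) * finrank ℚ (lefschetzLieRat Ψ G)) = 2 * (2 * finrank ℂ E ^ 2) :=
    calc _ = finrank ℚ (endAlgRat Ψ) * (2 * finrank ℚ (lefschetzLieRat Ψ G)) := by ring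
      _ = (2 * finrank ℂ E) ^ 2 := by rw [h1, h2]
      _ = 2 * (2 * finrank ℂ E ^ 2) := by ring
  omega

/-- TYPE IV in `𝔩𝔣 = Lie Lf(X)(ℝ)`: `[End_ℚ(X) : ℚ] · dim_ℝ 𝔩𝔣 = 2g²`. [cite: Milne1999LefschetzClasses, §2 Summary table (p. 652, type IV) and Remark 1.6] -/
theorem IsSimple.finrank_endAlgRat_mul_finrank_lefschetzLie_eq_of_isCMField (hX : IsSimple Ψ) (hη : IsRiemannForm Ψ η)
    (hG : G.map (Rat.cast : ℚ → ℝ) = latticeGram Ψ η) [IsCMField (centerField Ψ hX)] :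
    finrank ℚ (endAlgRat Ψ) * finrank ℝ (lefschetzLie Ψ G) = 2 * finrank ℂ E ^ 2 := by
  rw [← finrank_lefschetzLieRat_eq_finrank_lefschetzLie]
  exact hX.finrank_endAlgRat_mul_finrank_lefschetzLieRat_eq_of_isCMField hη hG

/-- **THE HODGE BOUND, TYPE IV: `[End_ℚ(X) : ℚ] · dim_ℝ 𝔥𝔤_ℝ ≤ 2g²`** (`Hg(X) ⊆ Lf(X) = S(X)`).
[cite: Milne1999LefschetzClasses, §4 («`Hg(A) ⊂ L(A)`») and §2 Summary table (p. 652, type IV)] -/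
theorem IsSimple.finrank_endAlgRat_mul_finrank_hodgeGroupLie_le_of_isCMField (hX : IsSimple Ψ) (hη : IsRiemannForm Ψ η)
    (hG : G.map (Rat.cast : ℚ → ℝ) = latticeGram Ψ η) [IsCMField (centerField Ψ hX)] :
    finrank ℚ (endAlgRat Ψ) * finrank ℝ (hodgeGroupLie Ψ) ≤ 2 * finrank ℂ E ^ 2 := by
  rw [← hX.finrank_endAlgRat_mul_finrank_lefschetzLie_eq_of_isCMField hη hG]
  exact Nat.mul_le_mul_left _ (hη.finrank_hodgeGroupLie_le_finrank_lefschetzLie hG)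

/-- **TYPE IV: `Hg(X)(ℂ) = Lf(X)(ℂ)` ⟺ `[End_ℚ(X) : ℚ] · dim_ℝ 𝔥𝔤_ℝ = 2g²`.** [cite: Milne1999LefschetzClasses, §2 (type IV) and §4 Prop. 4.8] -/
theorem IsSimple.hodgeGroupC_eq_lefschetzIdentityC_iff_finrank_endAlgRat_mul_finrank_hodgeGroupLie_eq_of_isCMField (hX : IsSimple Ψ)
    (hη : IsRiemannForm Ψ η) (hG : G.map (Rat.cast : ℚ → ℝ) = latticeGram Ψ η) [IsCMField (centerField Ψ hX)] :
    hodgeGroupC Ψ = lefschetzIdentityC Ψ G ↔ finrank ℚ (endAlgRat Ψ) * finrank ℝ (hodgeGroupLie Ψ) = 2 * finrank ℂ E ^ 2 := by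
  rw [hη.hodgeGroupC_eq_lefschetzIdentityC_iff_finrank_eq hG, ← hX.finrank_endAlgRat_mul_finrank_lefschetzLie_eq_of_isCMField hη hG]
  have he : 0 < finrank ℚ (endAlgRat Ψ) := by
    letI : DivisionRing (endAlgRat Ψ) := hX.divisionRing
    exact finrank_pos
  constructor
  · intro h'; rw [h']
  · intro h'; exact Nat.eq_of_mul_eq_mul_left he h'

/-- **MILNE'S TABLE, TYPE IV, READ OFF THE ALBERT TYPE**: for `(End_ℚ(X), ′)` of Albert type IV (`IsAlbertTypeIV`: centre a CM field, `′`
complex conjugation on it), `[End_ℚ(X) : ℚ] · dim_ℚ Lie S(X) = 2g²`.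
[cite: Milne1999LefschetzClasses, §2 «Simple abelian variety of type IV» (p. 651) and Summary table (p. 652)] [cite: Lange2023AbelianVarietiesComplex, §5.5 Lemma 2.6.6 (type IV)] -/
theorem IsSimple.finrank_endAlgRat_mul_finrank_lefschetzLieRat_eq_of_isAlbertTypeIV (hX : IsSimple Ψ) (hη : IsRiemannForm Ψ η)
    (hG : G.map (Rat.cast : ℚ → ℝ) = latticeGram Ψ η)
    (h : IsAlbertTypeIV (centerField Ψ hX) (endAlgRat Ψ) (rosatiEnd Ψ hη.1 hη.2.2 hG)) :
    finrank ℚ (endAlgRat Ψ) * finrank ℚ (lefschetzLieRat Ψ G) = 2 * finrank ℂ E ^ 2 := by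
  haveI := h.isCMField
  exact hX.finrank_endAlgRat_mul_finrank_lefschetzLieRat_eq_of_isCMField hη hG

/-- TYPE IV front-end, the Hodge bound: `[End_ℚ(X) : ℚ] · dim_ℝ 𝔥𝔤_ℝ ≤ 2g²`. [cite: Milne1999LefschetzClasses, §4 and §2 Summary table (type IV)] -/
theorem IsSimple.finrank_endAlgRat_mul_finrank_hodgeGroupLie_le_of_isAlbertTypeIV (hX : IsSimple Ψ) (hη : IsRiemannForm Ψ η)
    (hG : G.map (Rat.cast : ℚ → ℝ) = latticeGram Ψ η)
    (h : IsAlbertTypeIV (centerField Ψ hX) (endAlgRat Ψ) (rosatiEnd Ψ hη.1 hη.2.2 hG)) :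
    finrank ℚ (endAlgRat Ψ) * finrank ℝ (hodgeGroupLie Ψ) ≤ 2 * finrank ℂ E ^ 2 := by
  haveI := h.isCMField
  exact hX.finrank_endAlgRat_mul_finrank_hodgeGroupLie_le_of_isCMField hη hG

/-- TYPE IV front-end: `Hg(X)(ℂ) = Lf(X)(ℂ)` ⟺ `[End_ℚ(X) : ℚ] · dim_ℝ 𝔥𝔤_ℝ = 2g²`. [cite: Milne1999LefschetzClasses, §2 (type IV) and §4 Prop. 4.8] -/
theorem IsSimple.hodgeGroupC_eq_lefschetzIdentityC_iff_finrank_endAlgRat_mul_finrank_hodgeGroupLie_eq_of_isAlbertTypeIV (hX : IsSimple Ψ)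
    (hη : IsRiemannForm Ψ η) (hG : G.map (Rat.cast : ℚ → ℝ) = latticeGram Ψ η)
    (h : IsAlbertTypeIV (centerField Ψ hX) (endAlgRat Ψ) (rosatiEnd Ψ hη.1 hη.2.2 hG)) :
    hodgeGroupC Ψ = lefschetzIdentityC Ψ G ↔ finrank ℚ (endAlgRat Ψ) * finrank ℝ (hodgeGroupLie Ψ) = 2 * finrank ℂ E ^ 2 := by
  haveI := h.isCMField
  exact hX.hodgeGroupC_eq_lefschetzIdentityC_iff_finrank_endAlgRat_mul_finrank_hodgeGroupLie_eq_of_isCMField hη hG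

/-- **TYPE IV, CRITERION (D) ON ALL POWERS: `𝒟•(Xᵏ) = ℬ•(Xᵏ)` for all `k` ⟺ `[End_ℚ(X) : ℚ] · dim_ℝ 𝔥𝔤_ℝ = 2g²`** (for type IV `S(X)` is
connected — tree `IsSimple.lefschetzIdentityC_eq_lefschetzGroupC_of_isAlbertTypeIV` — so Milne's Prop. 4.8 reduces (D) to `Hg = Lf`, i.e. to
the dimension count). [cite: Milne1999LefschetzClasses, §4 Prop. 4.8 and §2 Summary table (type IV: «Connected: Yes»)] [cite: Lange2023AbelianVarietiesComplex, §7.2.4 Exercise (4)] -/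
theorem IsSimple.forall_divisorClasses_powPeriod_eq_hodgeClasses_iff_finrank_endAlgRat_mul_finrank_hodgeGroupLie_eq_of_isAlbertTypeIV
    (hX : IsSimple Ψ) (hη : IsRiemannForm Ψ η) (hG : G.map (Rat.cast : ℚ → ℝ) = latticeGram Ψ η)
    (h : IsAlbertTypeIV (centerField Ψ hX) (endAlgRat Ψ) (rosatiEnd Ψ hη.1 hη.2.2 hG)) :
    (∀ k p : ℕ, divisorClasses (powPeriod Ψ k) p = hodgeClasses (powPeriod Ψ k) p) ↔
      finrank ℚ (endAlgRat Ψ) * finrank ℝ (hodgeGroupLie Ψ) = 2 * finrank ℂ E ^ 2 := by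
  have hE : 0 < finrank ℂ E := by
    have := card_eq_two_mul_finrank Ψ
    have : 0 < Fintype.card κ := Fintype.card_pos
    omega
  rw [hη.forall_divisorClasses_powPeriod_eq_hodgeClasses_iff_eq_and_finrank_eq hG hE, ← hη.hodgeGroupC_eq_lefschetzIdentityC_iff_finrank_eq hG,
    hX.hodgeGroupC_eq_lefschetzIdentityC_iff_finrank_endAlgRat_mul_finrank_hodgeGroupLie_eq_of_isAlbertTypeIV hη hG h]
  exact ⟨fun h' ↦ h'.2, fun h' ↦ ⟨hX.lefschetzIdentityC_eq_lefschetzGroupC_of_isAlbertTypeIV hη hG h, h'⟩⟩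

/-- **TYPE IV: SOME POWER CARRIES AN EXOTIC HODGE CLASS ⟺ `[End_ℚ(X) : ℚ] · dim_ℝ 𝔥𝔤_ℝ < 2g²`** (the contrapositive reading: stably
degenerate iff the Hodge group is strictly smaller than `S(X) = Res U`). [cite: Milne1999LefschetzClasses, §4 Prop. 4.8] [cite: Murty1984ExceptionalHodgeClasses, §3] -/
theorem IsSimple.exists_divisorClasses_powPeriod_lt_hodgeClasses_iff_finrank_endAlgRat_mul_finrank_hodgeGroupLie_lt_of_isAlbertTypeIV
    (hX : IsSimple Ψ) (hη : IsRiemannForm Ψ η) (hG : G.map (Rat.cast : ℚ → ℝ) = latticeGram Ψ η)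
    (h : IsAlbertTypeIV (centerField Ψ hX) (endAlgRat Ψ) (rosatiEnd Ψ hη.1 hη.2.2 hG)) :
    (∃ k p : ℕ, divisorClasses (powPeriod Ψ k) p < hodgeClasses (powPeriod Ψ k) p) ↔
      finrank ℚ (endAlgRat Ψ) * finrank ℝ (hodgeGroupLie Ψ) < 2 * finrank ℂ E ^ 2 := by
  have hle := hX.finrank_endAlgRat_mul_finrank_hodgeGroupLie_le_of_isAlbertTypeIV hη hG h
  have hiff := hX.forall_divisorClasses_powPeriod_eq_hodgeClasses_iff_finrank_endAlgRat_mul_finrank_hodgeGroupLie_eq_of_isAlbertTypeIV hη hG h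
  constructor
  · rintro ⟨k, p, hkp⟩
    refine lt_of_le_of_ne hle fun heq ↦ ?_
    exact hkp.ne (hiff.2 heq k p)
  · intro hlt
    by_contra hne
    have hall : ∀ k p : ℕ, divisorClasses (powPeriod Ψ k) p = hodgeClasses (powPeriod Ψ k) p := fun k p ↦
      ((divisorClasses_le_hodgeClasses (powPeriod Ψ k) p).lt_or_eq).resolve_left fun hlt' ↦ hne ⟨k, p, hlt'⟩
    exact hlt.ne (hiff.1 hall)

/-! ## §4 The table's «Semisimple: No» for type IV: `Lie S(X)` has non-zero centre -/

omit [FiniteDimensional ℂ E] in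
/-- **TYPE IV: a non-zero central endomorphism in `Lie S(X)`** — for a CM centre `K` and `θ ∈ K×` with `θ̄ = −θ`, the endomorphism `θ` lies in
`Lie S(X)` (`θ† = θ̄ = −θ`, `θ` central in `End_ℚ(X)`) and commutes with all of `Lie S(X) ⊆ C(End_ℚ X)`.
[cite: Milne1999LefschetzClasses, §1 (p. 644) and §2 Summary table (p. 652: «IV ∣ `GL_{g/(df)}` ∣ Semisimple: No»)] [cite: Deligne1982HodgeCycles, I Prop. 5.1] -/
theorem IsSimple.exists_ne_zero_mem_lefschetzLieRat_forall_mul_comm_of_isCMField (hX : IsSimple Ψ) (hη : IsRiemannForm Ψ η)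
    (hG : G.map (Rat.cast : ℚ → ℝ) = latticeGram Ψ η) [IsCMField (centerField Ψ hX)] :
    ∃ A ∈ lefschetzLieRat Ψ G, A ≠ 0 ∧ A ∈ endAlgRat Ψ ∧ ∀ B ∈ lefschetzLieRat Ψ G, A * B = B * A := by
  set K := centerField Ψ hX
  have hGu : IsUnit G.det := isUnit_det_of_map_ratCast hG hη.isUnit_det_latticeGram
  obtain ⟨x₀, hx0, hxbar⟩ : ∃ x₀ : K, x₀ ≠ 0 ∧ IsCMField.complexConj K x₀ = -x₀ := by
    obtain ⟨x, hx⟩ : ∃ x : K, IsCMField.complexConj K x ≠ x := by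
      by_contra! h
      exact IsCMField.complexConj_ne_one K (AlgEquiv.ext h)
    exact ⟨x - IsCMField.complexConj K x, sub_ne_zero.2 hx.symm, by rw [map_sub, IsCMField.complexConj_apply_apply, neg_sub]⟩
  have hθL : centerField.val Ψ hX x₀ ∈ lefschetzLieRat Ψ G := by
    rw [mem_lefschetzLieRat_iff_rosati hGu]
    exact ⟨fun B hB ↦ centerField.val_comm Ψ hX x₀ hB, by rw [hX.rosati_val_eq_complexConj hη hG, hxbar, map_neg]⟩
  refine ⟨centerField.val Ψ hX x₀, hθL, fun h0 ↦ hx0 (centerField.val_injective Ψ hX (by rw [h0, map_zero])),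
    centerField.val_mem Ψ hX x₀, fun B hB ↦ ?_⟩
  exact (((mem_lefschetzLieRat_iff_rosati hGu).1 hB).1 _ (centerField.val_mem Ψ hX x₀)).symm

omit [FiniteDimensional ℂ E] in
/-- **TYPE IV: the centre of the `ℚ`-Lie algebra `Lie S(X)` is non-zero.** [cite: Milne1999LefschetzClasses, §2 Summary table (p. 652: «IV ∣ `GL_{g/(df)}` ∣ Semisimple: No»)] -/
theorem IsSimple.center_lefschetzLieRat_ne_bot_of_isCMField (hX : IsSimple Ψ) (hη : IsRiemannForm Ψ η)
    (hG : G.map (Rat.cast : ℚ → ℝ) = latticeGram Ψ η) [IsCMField (centerField Ψ hX)] :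
    LieAlgebra.center ℚ ↥(lefschetzLieRat Ψ G) ≠ ⊥ := by
  letI : LieRing (Matrix κ κ ℚ) := LieRing.ofAssociativeRing
  letI : LieAlgebra ℚ (Matrix κ κ ℚ) := LieAlgebra.ofAssociativeAlgebra
  obtain ⟨A, hAL, hA0, -, hcomm⟩ := hX.exists_ne_zero_mem_lefschetzLieRat_forall_mul_comm_of_isCMField hη hG
  intro hbot
  have hmem : (⟨A, hAL⟩ : lefschetzLieRat Ψ G) ∈ LieAlgebra.center ℚ ↥(lefschetzLieRat Ψ G) := by
    rw [LieModule.mem_maxTrivSubmodule]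
    intro x
    apply Subtype.ext
    rw [LieSubalgebra.coe_bracket, Ring.lie_def, hcomm x.1 x.2, sub_self]
    rfl
  rw [hbot, LieSubmodule.mem_bot] at hmem
  exact hA0 (congrArg Subtype.val hmem)

omit [FiniteDimensional ℂ E] in
/-- **MILNE'S TABLE, TYPE IV: «Semisimple: No» — `Lie S(X)` is NOT a semisimple Lie algebra** for a simple polarised complex torus whose
endomorphism algebra has a CM centre (a semisimple Lie algebra has trivial centre). [cite: Milne1999LefschetzClasses, §2 Summary table (p. 652: «IV ∣ `GL_{g/(df)}` ∣ Semisimple: No»)] -/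
theorem IsSimple.not_isSemisimple_lefschetzLieRat_of_isCMField (hX : IsSimple Ψ) (hη : IsRiemannForm Ψ η)
    (hG : G.map (Rat.cast : ℚ → ℝ) = latticeGram Ψ η) [IsCMField (centerField Ψ hX)] :
    ¬ LieAlgebra.IsSemisimple ℚ ↥(lefschetzLieRat Ψ G) := by
  intro hss
  exact hX.center_lefschetzLieRat_ne_bot_of_isCMField hη hG (LieAlgebra.center_eq_bot ℚ _)

omit [FiniteDimensional ℂ E] in
/-- Type IV front-end: for `(End_ℚ(X), ′)` of Albert type IV, `Lie S(X)` is not semisimple. [cite: Milne1999LefschetzClasses, §2 Summary table (p. 652: «IV ∣ … ∣ Semisimple: No»)] -/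
theorem IsSimple.not_isSemisimple_lefschetzLieRat_of_isAlbertTypeIV (hX : IsSimple Ψ) (hη : IsRiemannForm Ψ η)
    (hG : G.map (Rat.cast : ℚ → ℝ) = latticeGram Ψ η)
    (h : IsAlbertTypeIV (centerField Ψ hX) (endAlgRat Ψ) (rosatiEnd Ψ hη.1 hη.2.2 hG)) :
    ¬ LieAlgebra.IsSemisimple ℚ ↥(lefschetzLieRat Ψ G) := by
  haveI := h.isCMField
  exact hX.not_isSemisimple_lefschetzLieRat_of_isCMField hη hG

end TypeFour

end ComplexTorus

end Literature.Geometry.Kaehler
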